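import Summits.QuantumFields.BalabanUV.Beta.MultiscaleDecay

/-!
# `Summit.QuantumFields.BalabanUV.Beta.MultiscaleGradientCoercive` — engine file 20a: the CONJUGATED COERCIVITY OF `levelOp`
# WITH THE DIRICHLET TERM RETAINED — `μ₀·Σ_b |(D v)(b)|² ≤ C·Σ_p e^{κd_n(p)}v_p·(levelOp(e^{−κd_n}v))_p` for EVERY isometric
# transport — the energy half that `MultiscaleDecay.hc_levelOp` discards, feeding the ℓ² GRADIENT members (3.46)₂,₃ (file 20b)

HONEST FRAMING (page 1 of everything in this cell).  Discharging `FlowStep.BetaPertH` would make Bałaban's ultraviolet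
stability UNCONDITIONAL — a constructive-QFT result; it is NOT the continuum limit and NOT the Clay problem.  This module
discharges nothing of `BetaPertH`; it is [folklore] finite-dimensional bookkeeping about the MODEL operator, kernel-checked, by the
OWNER of binder row D4 (unit `b2b-balaban-beta-an4`, gen 46).  HONEST DEPENDENCY: continuum YM on T⁴ ⇐ BetaPertH ∧ nine spine
estimates (0/9 proved); BetaPertH ⇐ (D1) ∧ (D4) ∧ CAP+tail; G-an2-4 gates asym, D1 and NE2/3/4.

THE POINT (O.2 item (i), the ℓ² gradient members; MODEL level; NOT the critical path).  [B9] Thm 3.1 (3.46) p. 398 lists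
`‖h∇_UG′(U)λ‖, ‖hG′(U)∇*_Uλ‖ ≤ B₀·L^jη·|h|e^{−δ₀d(y,y′)}‖λ‖`.  Census E-an4-141d (4) located them as GEOMETRY-FREE at MODEL level:
unlike the pointwise gradient member (which fails level-free for rough transports — the π-flux witness), the ℓ² gradient members follow
for EVERY isometric `Rm` from the conjugated ENERGY identity.  `MultiscaleDecay.hc_levelOp` proved
`μ₀·Σ_p n(p)⁻²v_p² ≤ ⟨e^{κρ}v, levelOp(e^{−κρ}v)⟩` with `μ₀ = C − 2d·c_max²κ² − a_max(e^{2dκ} − 1)` by combining the cell-sum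
coercivity `C·Σn⁻²|v|² ≤ ⟨v, levelOp v⟩` with the conjugation-error budgets; it THREW AWAY the Dirichlet energy `Σ_b|(Dv)(b)|² ≤
⟨v, levelOp v⟩` (`qform_levelOp`: `⟨v, levelOp v⟩ = Σ_b (Dv)_b² + Σ_l a_lΣ(G_lv)²`).  THIS FILE keeps it: with `Q = ⟨v, levelOp v⟩`,
`E` the conjugation error, `B = 2dc_max²κ² + a_max(e^{2dκ}−1)`, `H = Σn⁻²|v|²`, `𝒟 = Σ_b|(Dv)(b)|²` one has `E ≥ −B·H`, `C·H ≤ Q`,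
`𝒟 ≤ Q`, hence `C(Q + E) ≥ CQ − C·B·H ≥ CQ − B·Q = μ₀Q ≥ μ₀𝒟` — **`hgrad_levelOp`**: `μ₀·Σ_q (D v)(q)² ≤ C·⟨e^{κρ}v, levelOp(e^{−κρ}v)⟩`
for every real `v`, every target site, every isometric `Rm`, constants `d, c_max, a_max, C` only.  File 20b turns this (with
`hc_levelOp`) into the cell-to-cell ℓ² bound `‖1_{cell k}D(levelOp)⁻¹1_{cell k′}‖ ≲ n_{k′}e^{−κd_n}` — (3.46)₂'s SHAPE.  WHAT THIS IS NOT: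
nothing of Bałaban's G′(U); (3.46) is a LOCATOR; row D4 readiness width 0; D4 DISCHARGE NO DATE.

WHAT IS CERTIFIED (kernel, 0 sorry, 0 def): **`hgrad_levelOp`**.  LOCATORS (shape only; ABSOLUTE RULE — nothing printed is asserted):
[Balaban1985BackgroundPropagators] (3.16) p. 393, (3.23)–(3.24) p. 394, Thm 3.1 (3.46) p. 398.  NOT BetaPertH, NOT continuum, NOT Clay.
-/

namespace Summit.QuantumFields.BalabanUV.Beta.MultiscaleGradientCoercive

open Finset Function
open Summit.QuantumFields.BalabanUV.Beta.BoxPoincare (Box)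
open Summit.QuantumFields.BalabanUV.Beta.MultiscaleCoerciveTorus
open Summit.QuantumFields.BalabanUV.Beta.MultiscaleConjError (siteSq siteSq_nonneg conjErr_levelOp_ge_local_cosh conjForm_eq)
open Summit.QuantumFields.BalabanUV.Beta.MultiscaleDistance
open Summit.QuantumFields.BalabanUV.Beta.MultiscaleDecayBudget
open Literature.MathematicalPhysics.QuantumFieldTheory.Balaban1983to89
open Literature.MathematicalPhysics.QuantumFieldTheory.Balaban1983to89.B9Thm37Glue (covD)
open Literature.MathematicalPhysics.QuantumFieldTheory.Balaban1983to89.B9Thm37GluePU (bsrc btgt bsrc_apply btgt_apply)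
open Literature.MathematicalPhysics.QuantumFieldTheory.Balaban1983to89.B9Thm37GlueTorusCov (tblk torusComb)
open Literature.MathematicalPhysics.QuantumFieldTheory.Balaban1983to89.B9Thm37GlueTorusCovComp (gMean)
open Literature.MathematicalPhysics.QuantumFieldTheory.Balaban1983to89.B9Thm37GlueTorusCovLevels (levelOp qform_levelOp)
open Literature.MathematicalPhysics.QuantumFieldTheory.Balaban1983to89.B9Thm37GlueTorusCovCT (expW conjErr)
open B5TorusCover (UT Ctr ctrU)

noncomputable section

variable {d : ℕ} {N : Fin d → ℕ} [∀ i, NeZero (N i)] [NeZero d] {Cp J K : Type} [Fintype Cp] [DecidableEq Cp] [Fintype J] [Fintype K]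
  (S : J → ℕ) (hS : ∀ l, 1 ≤ S l) (hdivS : ∀ l i, S l ∣ N i) (lvl : K → J) (zc : (k : K) → Ctr N (S (lvl k)))

/-- **THE CONJUGATED COERCIVITY OF `levelOp` WITH THE DIRICHLET TERM (MODEL; every isometric transport).**  Torus `UT N`; isometric
`Rm`, `T`; `a ≥ 0`; level weights `ω_l` supported on the level-`l` cells of a disjoint covering family (`hsupp`) and print-size from
above (`a_lω_l²S_l^d ≤ a_max/S_l²`); `|c| ≤ c_max`; a cell-sum coercivity with constant `C`; `0 ≤ κ ≤ 1` with the margin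
`μ₀ = C − 2d·c_max²κ² − a_max(e^{2dκ} − 1) > 0`.  Then for every target `y` and every real `v`, with `φ = κ·d_n(·, y₁)`:
`μ₀ · Σ_q ((D v)(q))² ≤ C · Σ_p e^{φ(p₁)}v_p·(levelOp(e^{−φ}v))_p` — the Dirichlet energy of the conjugating field `v` (NOT of
`e^{−φ}v`; file 20b pays the commutator) is controlled by the conjugated pairing.  Proof: `E ≥ −B·H` (conjugation-error budgets of
`hc_levelOp`), `C·H ≤ Q` (coercivity), `Σ(Dv)² ≤ Q` (`qform_levelOp`), assembled as `C(Q+E) ≥ CQ − CBH ≥ CQ − BQ = μ₀Q ≥ μ₀Σ(Dv)²`.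
[cite: Balaban1985BackgroundPropagators, (3.24) p.394 + Thm 3.1 (3.46) p.398] [folklore] -/
theorem hgrad_levelOp (hdisj : ∀ k k' v v', cellPt S hS hdivS lvl zc k v = cellPt S hS hdivS lvl zc k' v' → k = k')
    (hcover : ∀ x : UT N, ∃ k, ∃ v : Box d (S (lvl k)), cellPt S hS hdivS lvl zc k v = x)
    (Rm : UT N × Fin d → Cp → Cp → ℝ) (hRm : ∀ b i j, ∑ k, Rm b k i * Rm b k j = if i = j then (1 : ℝ) else 0)
    (T : J → UT N → Cp → Cp → ℝ) (hT : ∀ l x i i', ∑ k, T l x k i * T l x k i' = if i = i' then (1 : ℝ) else 0)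
    (a : J → ℝ) (ha : ∀ j, 0 ≤ a j) (ω : J → UT N → ℝ)
    (hsupp : ∀ l x, ω l (ctrU N (S l) (tblk (hS l) (hdivS l) x)) ≠ 0 → ∃ k v, lvl k = l ∧ cellPt S hS hdivS lvl zc k v = x)
    {amax : ℝ} (hamax : 0 ≤ amax)
    (hscale : ∀ k, a (lvl k) * ω (lvl k) (ctrU N (S (lvl k)) (zc k)) ^ 2 * (S (lvl k) : ℝ) ^ d ≤ amax / (S (lvl k) : ℝ) ^ 2)
    (c : UT N × Fin d → ℝ) {cmax : ℝ} (hc : ∀ b, |c b| ≤ cmax) {C : ℝ}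
    (hcoer : ∀ f : UT N × Cp → ℝ,
      C * ∑ k, ((S (lvl k) : ℝ) ^ 2)⁻¹ * ∑ v : Box d (S (lvl k)), ∑ i, f (cellPt S hS hdivS lvl zc k v, i) ^ 2 ≤
        ∑ p, f p * levelOp bsrc btgt c Rm (fun l x => ctrU N (S l) (tblk (hS l) (hdivS l) x))
          (fun l x => ω l (ctrU N (S l) (tblk (hS l) (hdivS l) x))) T a f p)
    {κ : ℝ} (hκ0 : 0 ≤ κ) (hκ1 : κ ≤ 1) (hμ : 0 < C - 2 * d * cmax ^ 2 * κ ^ 2 - amax * (Real.exp (2 * d * κ) - 1))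
    (y : UT N × Cp) (v : UT N × Cp → ℝ) :
    (C - 2 * d * cmax ^ 2 * κ ^ 2 - amax * (Real.exp (2 * d * κ) - 1)) *
        ∑ q, (covD bsrc btgt c Rm v q) ^ 2 ≤
      C * ∑ p, Real.exp (κ * sdist bsrc btgt (siteScale S hS hdivS lvl zc hcover) p.1 y.1) * v p *
        levelOp bsrc btgt c Rm (fun l x => ctrU N (S l) (tblk (hS l) (hdivS l) x))
          (fun l x => ω l (ctrU N (S l) (tblk (hS l) (hdivS l) x))) T a
          (fun q => Real.exp (-(κ * sdist bsrc btgt (siteScale S hS hdivS lvl zc hcover) q.1 y.1)) * v q) p := by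
  classical
  set n := siteScale S hS hdivS lvl zc hcover with hn
  set A := levelOp bsrc btgt c Rm (fun l x => ctrU N (S l) (tblk (hS l) (hdivS l) x))
    (fun l x => ω l (ctrU N (S l) (tblk (hS l) (hdivS l) x))) T a with hA
  set φ : UT N → ℝ := fun x => κ * sdist bsrc btgt n x y.1 with hφ
  have hn1 : ∀ x, 1 ≤ n x := one_le_siteScale S hS hdivS lvl zc hcover
  -- the conjugated pairing is ⟨v, Av⟩ + ERR
  have hpair : ∑ p, Real.exp (κ * sdist bsrc btgt n p.1 y.1) * v p *
      A (fun q => Real.exp (-(κ * sdist bsrc btgt n q.1 y.1)) * v q) p = ∑ p, v p * A v p + conjErr A φ v := by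
    rw [← conjForm_eq A φ v]
    rfl
  rw [hpair]
  -- the site energies
  set F : UT N → ℝ := siteSq v with hF
  have hF0 : ∀ x, 0 ≤ F x := siteSq_nonneg v
  -- (1) the sitewise coercivity
  have hco : C * ∑ x, ((n x : ℝ) ^ 2)⁻¹ * F x ≤ ∑ p, v p * A v p := by
    rw [hn, ← sum_cells_scale_eq S hS hdivS lvl zc hdisj hcover]
    exact hcoer v
  -- (1') the Dirichlet energy is below the quadratic form
  have hqD : ∑ q, (covD bsrc btgt c Rm v q) ^ 2 ≤ ∑ p, v p * A v p := by
    have hq := qform_levelOp bsrc btgt c Rm (fun l x => ctrU N (S l) (tblk (hS l) (hdivS l) x))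
      (fun l x => ω l (ctrU N (S l) (tblk (hS l) (hdivS l) x))) T a v
    rw [← hA] at hq
    rw [hq]
    have hlev : 0 ≤ ∑ j, a j * ∑ q, gMean (fun x => ctrU N (S j) (tblk (hS j) (hdivS j) x))
        (fun x => ω j (ctrU N (S j) (tblk (hS j) (hdivS j) x))) (T j) v q *
        gMean (fun x => ctrU N (S j) (tblk (hS j) (hdivS j) x)) (fun x => ω j (ctrU N (S j) (tblk (hS j) (hdivS j) x))) (T j) v q :=
      Finset.sum_nonneg fun j _ => mul_nonneg (ha j) (Finset.sum_nonneg fun q _ => mul_self_nonneg _)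
    have hsq : ∑ q, (covD bsrc btgt c Rm v q) ^ 2 = ∑ q, covD bsrc btgt c Rm v q * covD bsrc btgt c Rm v q :=
      Finset.sum_congr rfl fun q _ => sq _
    rw [hsq]
    linarith
  -- (2) the conjugation error: budgets
  set θ : UT N × Fin d → ℝ := fun b => κ * slen n (bsrc b) (btgt b) with hθ
  have hφb : ∀ b, |φ (btgt b) - φ (bsrc b)| ≤ θ b := by
    intro b
    rw [hφ, hθ]
    simp only
    rw [← mul_sub, abs_mul, abs_of_nonneg hκ0]
    exact mul_le_mul_of_nonneg_left (abs_sdist_tgt_sub_src_le bsrc btgt n b y.1) hκ0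
  set Posc : J → UT N → Prop := fun l β => ∀ x x', ctrU N (S l) (tblk (hS l) (hdivS l) x) = β →
    ctrU N (S l) (tblk (hS l) (hdivS l) x') = β →
      |κ * sdist bsrc btgt n x y.1 - κ * sdist bsrc btgt n x' y.1| ≤ κ * (2 * ((d * (S l - 1) : ℕ) : ℝ) * (S l : ℝ)⁻¹) with hPosc
  set Θ : J → UT N → ℝ := fun l β => if Posc l β then κ * (2 * ((d * (S l - 1) : ℕ) : ℝ) * (S l : ℝ)⁻¹) else ∑ z, φ z with hΘ
  have hφ0 : ∀ z, 0 ≤ φ z := fun z => mul_nonneg hκ0 (sdist_nonneg bsrc btgt n z y.1)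
  have hΘ0 : ∀ l β, 0 ≤ Θ l β := by
    intro l β
    rw [hΘ]
    simp only
    split_ifs
    · positivity
    · exact sum_nonneg fun z _ => hφ0 z
  have hΘP : ∀ l β, Posc l β → Θ l β = κ * (2 * ((d * (S l - 1) : ℕ) : ℝ) * (S l : ℝ)⁻¹) := by
    intro l β hP
    rw [hΘ]
    simp only
    rw [if_pos hP]
  have hosc : ∀ l x x', ctrU N (S l) (tblk (hS l) (hdivS l) x) = ctrU N (S l) (tblk (hS l) (hdivS l) x') →
      |φ x - φ x'| ≤ Θ l (ctrU N (S l) (tblk (hS l) (hdivS l) x)) := by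
    intro l x x' hxx'
    rw [hΘ]
    simp only
    split_ifs with hP
    · exact hP x x' rfl hxx'.symm
    · rw [abs_sub_le_iff]
      constructor
      · linarith [hφ0 x', Finset.single_le_sum (f := φ) (fun z _ => hφ0 z) (mem_univ x)]
      · linarith [hφ0 x, Finset.single_le_sum (f := φ) (fun z _ => hφ0 z) (mem_univ x')]
  have herr := conjErr_levelOp_ge_local_cosh bsrc btgt c Rm (fun l x => ctrU N (S l) (tblk (hS l) (hdivS l) x))
    (fun l x => ω l (ctrU N (S l) (tblk (hS l) (hdivS l) x))) T a hRm hT ha (fun l β => |ω l β|) (fun l x => le_rfl)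
    (fun l β => S l ^ d) (fun l β => card_block_le (hS l) (hdivS l) β) φ θ hφb Θ hΘ0 hosc v
  have hbond := bond_budget_le hn1 c hc hκ0 hκ1 F hF0
  have havg := avg_budget_le S hS hdivS lvl zc hdisj hcover a ω hsupp hamax hscale hκ0 y.1 Θ hΘP F hF0
  -- (3) assemble: abbreviate the five real quantities
  set Q : ℝ := ∑ p, v p * A v p with hQ
  set E : ℝ := conjErr A φ v with hE
  set H : ℝ := ∑ x, ((n x : ℝ) ^ 2)⁻¹ * F x with hH
  set Dq : ℝ := ∑ q, (covD bsrc btgt c Rm v q) ^ 2 with hDq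
  set B₁ : ℝ := 2 * d * cmax ^ 2 * κ ^ 2 with hB₁
  set B₂ : ℝ := amax * (Real.exp (2 * d * κ) - 1) with hB₂
  have hnB : ∀ l (β : UT N), (((fun (_ : J) (_ : UT N) => S l ^ d) l β : ℕ) : ℝ) = ((S l ^ d : ℕ) : ℝ) := fun _ _ => rfl
  -- the error is bounded below by the two budgets
  have hEB : -(B₁ * H) - B₂ * H ≤ E := by
    rw [hB₁, hB₂, hH, hE]
    linarith [herr, hbond, havg]
  have hB₁0 : 0 ≤ B₁ := by rw [hB₁]; positivity
  have hB₂0 : 0 ≤ B₂ := by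
    rw [hB₂]
    refine mul_nonneg hamax ?_
    have : 0 ≤ 2 * (d : ℝ) * κ := by positivity
    linarith [Real.one_le_exp_iff.mpr this]
  have hC0 : 0 < C := by
    have : C - B₁ - B₂ = C - 2 * d * cmax ^ 2 * κ ^ 2 - amax * (Real.exp (2 * d * κ) - 1) := by rw [hB₁, hB₂]
    linarith
  have hμ' : 0 ≤ C - B₁ - B₂ := by rw [hB₁, hB₂]; exact hμ.le
  -- the four product facts
  have s1 : -(C * (B₁ * H)) - C * (B₂ * H) ≤ C * E := by
    have := mul_le_mul_of_nonneg_left hEB hC0.le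
    linarith [this, show C * (-(B₁ * H) - B₂ * H) = -(C * (B₁ * H)) - C * (B₂ * H) by ring]
  have s2 : B₁ * (C * H) ≤ B₁ * Q := mul_le_mul_of_nonneg_left hco hB₁0
  have s3 : B₂ * (C * H) ≤ B₂ * Q := mul_le_mul_of_nonneg_left hco hB₂0
  have s4 : (C - B₁ - B₂) * Dq ≤ (C - B₁ - B₂) * Q := mul_le_mul_of_nonneg_left hqD hμ'
  have e1 : C * (B₁ * H) = B₁ * (C * H) := by ring
  have e2 : C * (B₂ * H) = B₂ * (C * H) := by ring
  have goal' : (C - B₁ - B₂) * Dq ≤ C * (Q + E) := by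
    have hsplit : (C - B₁ - B₂) * Q = C * Q - B₁ * Q - B₂ * Q := by ring
    rw [mul_add]
    linarith [s1, s2, s3, s4, e1, e2, hsplit]
  rw [hB₁, hB₂] at goal'
  exact goal'

end

end Summit.QuantumFields.BalabanUV.Beta.MultiscaleGradientCoercive
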